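import Mathlib
import HarnessLib
import Literature.MathematicalPhysics.QuantumLattice.KohnLuttinger
import Literature.MathematicalPhysics.QuantumLattice.SymmetricRegimeFunctionalsD4
import Summits.HubbardSuperconductivity.HubbardSuperconductivity.Theorems.KLProgrammeCooperChannelRiccatiFlowDefs

/-!
# Route `KLProgramme` — vocabulary D2 (abstract + finite-volume half): `D₄` blocks of a Cooper vertex
# (cell gate-hubbard-kl, seat p3; definition request `defn-HubbardCooperVertexBlocks`, DECOMP v7 §8(h) 3,
# HOME/planner-g4/D-items.md D2, HOME/p3/D2-ABSTRACT-HALF.md)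

The block-Riccati comparison of DECOMP C2 (`Theorems/KLProgrammeCooperChannelRiccatiFlow*.lean`) is stated
for ONE block: a bounded (symmetric) operator `V` on a complex inner-product space and the two ends
`formInf V`, `formSup V` of its form.  This file NAMES how such blocks arise from a `D₄`-covariant Cooper
vertex — nothing is proved here:

§1 GENERIC LAYER (any complex inner-product space `E` with a map `ρ : D₄ → (E →L[ℂ] E)`, meant to be a unitary
representation of the point group of the square lattice; irreps and characters are the tree's
`Literature.MathematicalPhysics.QuantumLattice.D4Irrep`, `D4Irrep.char`, `D4Irrep.dim` of `KohnLuttinger.lean`):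
* `isotypicProj ρ χ = (dim χ / 8) Σ_g χ(g) ρ_g` — the isotypic projection onto the channel `χ` (the operator
  form of the tree's `d4Project` on functions);
* `channelSubspace ρ χ = {v | isotypicProj ρ χ v = v}` — the channel `χ` as a submodule `E_χ` of `E` (an
  inner-product space in its own right);
* `channelFormInf ρ A χ = inf {Re ⟪v, A v⟫ : ‖v‖ = 1, v ∈ E_χ}` and `channelFormSup ρ A χ = -channelFormInf ρ (-A) χ`
  — the bottom / top of the form of `A` ON THE CHANNEL (`= formInf` / `formSup` of the block, see `blockOp`);
* `blockOp ρ χ A hA : E_χ →L[ℂ] E_χ` — the block of an operator `A` leaving `E_χ` invariant (every `A`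
  commuting with `ρ` does): THE object C2's theorems (`formInf_cascade`, `blockFlow_envelopes`, …) apply to.

§2 FINITE-VOLUME INSTANCE (the route's model binding at finite `(β, L, M)`): on
`ℓ²((ℤ/Lℤ)²) = EuclideanSpace ℂ (TorusSite 2 L)` the point group acts by the permutation representation
`d4PermRep L g : v ↦ v ∘ g⁻¹` (`d4SitePerm` of `FockRelabel.lean`); the Cooper matrix
`cooperMatrix L M β e Λ G` of an element `G` of the Hubbard Grassmann algebra (`SymmetricRegimeFunctionals.lean`:
the amputated four-point kernel at Cooper kinematics `(k↑,-k↓) → (k'↑,-k'↓)`, external frequencies `±π/β`,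
dressed with the BCS shell measure on the shell `|e| ≤ Λ` of the band `e`) becomes the operator
`cooperOp L M β e Λ G`, which commutes with `d4PermRep` whenever `G`'s kernels and `e` are `D₄`-invariant
(`cooperMatrix_d4Site`, `cooperMatrix_hubbardEffectiveActionCT_d4Site`); its channel bottoms / tops are
`cooperChannelInf/Sup L M β e Λ G χ`, and for the countertermed effective action at scale `Λ`
(`hubbardEffectiveActionCT L M β U μ 0 K Λ`, band `e_K = nambuXiCT L μ K`) they are
`klScaleBlockInf/Sup L M β U μ K Λ χ` — the finite-volume ancestors of the blocks `V_h^Γ` of DECOMP App. E,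
Lemma E.4 (`Λ = γ^h`).

What is NOT here (recorded for the planner, DECOMP §8(h) 3): (i) the ISOTROPIC-SECTOR array of the quartic
kernel and the pp-transfer scale of a sector 4-tuple (the non-Cooper half of child 1 `KLRegimeBetaSplit`;
vocabulary = `SectorisedKernelNorm.lean`'s `sectorisedKernel`/`bgmMultiplier` at doubled angular resolution);
(ii) the `L → ∞` / continuum blocks on `L²(F_μ, ds/|∇ε|)` and the bridge `channelInf = channelFormInf` to the
certificate's `channelInf` (HOME/p3/D2-ABSTRACT-HALF.md §2 (b): needs the `RCLike` port of
`Literature/Analysis/OperatorTheory/L2KernelIntegralOperator.lean`); (iii) any claim about any model.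

References: HOME/DECOMP.md v7 §2 C2/C3, §8(h) 3, App. E (E1, E2, Lemma E.4); HOME/planner-g4/D-items.md D2;
D. J. Scalapino, Phys. Rep. 250 (1995) 329, §2 (pair channels of the square lattice by `C₄ᵥ` irreps);
S. Raghu, S. A. Kivelson, D. J. Scalapino, Phys. Rev. B 81 (2010) 224505, §III (17) (the isotypic projections).
-/

noncomputable section

namespace Summit.HubbardSuperconductivity.HubbardSuperconductivity.Theorems.CooperVertexBlocks

set_option linter.dupNamespace false -- summit = problem name (single-conjunct summit), D-0017

open scoped InnerProductSpace
open Literature.MathematicalPhysics.QuantumLattice Literature.Probability.LatticeModels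
open Summit.HubbardSuperconductivity.HubbardSuperconductivity.Theorems.CooperChannelRiccatiFlow

/-! ## §1 Generic layer: isotypic projections, channel subspaces, channel form bottoms, block operators -/

section Generic

variable {E : Type*} [NormedAddCommGroup E] [InnerProductSpace ℂ E]

/-- The **isotypic projection** onto the channel `χ` of a `D₄`-action `ρ` on `E`:
`P_χ = (dim χ / 8) Σ_{g ∈ D₄} χ(g) ρ_g` (real characters, every element of `D₄` conjugate to its inverse; for a
unitary representation `ρ` this is the orthogonal projection onto the `χ`-isotypic component). -/
def isotypicProj (ρ : DihedralGroup 4 → E →L[ℂ] E) (χ : D4Irrep) : E →L[ℂ] E :=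
  ((χ.dim : ℂ) / 8) • ∑ g : DihedralGroup 4, ((χ.char g : ℝ) : ℂ) • ρ g

/-- The **channel subspace** `E_χ = {v | P_χ v = v}` of the `D₄`-action `ρ` (a submodule of `E`; with the induced
inner product it is the space on which the `χ`-block of a `D₄`-covariant operator acts). -/
def channelSubspace (ρ : DihedralGroup 4 → E →L[ℂ] E) (χ : D4Irrep) : Submodule ℂ E :=
  LinearMap.eqLocus ((isotypicProj ρ χ : E →L[ℂ] E) : E →ₗ[ℂ] E) LinearMap.id

/-- **Bottom of the form of `A` on the channel `χ`**: `inf {Re ⟪v, A v⟫ : ‖v‖ = 1, P_χ v = v}` (`sInf` in `ℝ`,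
junk `0` on an empty channel) — for an operator leaving `E_χ` invariant this is `formInf` of its block
(`blockOp`), the quantity DECOMP C2 follows scale by scale. -/
def channelFormInf (ρ : DihedralGroup 4 → E →L[ℂ] E) (A : E →L[ℂ] E) (χ : D4Irrep) : ℝ :=
  sInf ((fun v : E => RCLike.re ⟪v, A v⟫_ℂ) '' {v : E | ‖v‖ = 1 ∧ isotypicProj ρ χ v = v})

/-- **Top of the form of `A` on the channel `χ`**: `channelFormSup ρ A χ = -channelFormInf ρ (-A) χ`. -/
def channelFormSup (ρ : DihedralGroup 4 → E →L[ℂ] E) (A : E →L[ℂ] E) (χ : D4Irrep) : ℝ :=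
  -channelFormInf ρ (-A) χ

/-- **The `χ`-block of an operator** `A` that leaves the channel subspace invariant (hypothesis `hA`; every `A`
commuting with all `ρ_g` qualifies): the restriction `A|_{E_χ} : E_χ →L[ℂ] E_χ` — the bounded operator on the
complex inner-product space `E_χ` to which the comparison theorems of `KLProgrammeCooperChannelRiccatiFlow*.lean`
apply verbatim. -/
def blockOp (ρ : DihedralGroup 4 → E →L[ℂ] E) (χ : D4Irrep) (A : E →L[ℂ] E)
    (hA : ∀ v ∈ channelSubspace ρ χ, A v ∈ channelSubspace ρ χ) :
    channelSubspace ρ χ →L[ℂ] channelSubspace ρ χ :=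
  (A.comp (channelSubspace ρ χ).subtypeL).codRestrict (channelSubspace ρ χ) fun v => hA v v.2

end Generic

/-! ## §2 Finite-volume instance: the Cooper matrix of a Grassmann effective action on `ℓ²((ℤ/Lℤ)²)` -/

section FiniteVolume

variable (L M : ℕ) [NeZero L]

/-- The **permutation representation of `D₄` on `ℓ²((ℤ/Lℤ)²)`**: `(ρ_g v)(k⃗) = v(g⁻¹ k⃗)`, `g` acting on the torus
momenta by `d4Site` (`d4SitePerm`, a group homomorphism into the permutations); each `ρ_g` is a linear isometry
(`LinearIsometryEquiv.piLpCongrLeft`). -/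
def d4PermRep (g : DihedralGroup 4) : EuclideanSpace ℂ (TorusSite 2 L) →L[ℂ] EuclideanSpace ℂ (TorusSite 2 L) :=
  ((LinearIsometryEquiv.piLpCongrLeft 2 ℂ ℂ (d4SitePerm (L := L) g)).toContinuousLinearEquiv :
    EuclideanSpace ℂ (TorusSite 2 L) →L[ℂ] EuclideanSpace ℂ (TorusSite 2 L))

variable [NeZero M]

/-- The **Cooper operator** of an element `G` of the Hubbard Grassmann algebra: the tree's Cooper matrix
`cooperMatrix L M β e Λ G` (`A(k⃗,k⃗') = 𝟙_S √ν 𝒞 √ν`, shell `S = {|e| ≤ Λ}`, BCS measure `ν`, Cooper amplitude `𝒞` =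
the four-point vertex function at `(k↑,-k↓) → (k'↑,-k'↓)`, external frequencies `±π/β`) as a bounded operator on
`EuclideanSpace ℂ (TorusSite 2 L)` (`Matrix.toEuclideanCLM`). -/
def cooperOp (β : ℝ) (e : TorusSite 2 L → ℝ) (Λ : ℝ) (G : HubbardGrassmann L M) :
    EuclideanSpace ℂ (TorusSite 2 L) →L[ℂ] EuclideanSpace ℂ (TorusSite 2 L) :=
  Matrix.toEuclideanCLM (n := TorusSite 2 L) (𝕜 := ℂ) (cooperMatrix L M β e Λ G)

/-- **Bottom of the `χ`-block of the Cooper operator** of `G` (band `e`, scale `Λ`): `channelFormInf` for the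
permutation representation. -/
def cooperChannelInf (β : ℝ) (e : TorusSite 2 L → ℝ) (Λ : ℝ) (G : HubbardGrassmann L M) (χ : D4Irrep) : ℝ :=
  channelFormInf (d4PermRep L) (cooperOp L M β e Λ G) χ

/-- **Top of the `χ`-block of the Cooper operator** of `G` (band `e`, scale `Λ`). -/
def cooperChannelSup (β : ℝ) (e : TorusSite 2 L → ℝ) (Λ : ℝ) (G : HubbardGrassmann L M) (χ : D4Irrep) : ℝ :=
  channelFormSup (d4PermRep L) (cooperOp L M β e Λ G) χ

/-- **The scale-`Λ` Cooper block bottoms of the KL programme at finite volume**: the channel bottoms of the Cooper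
operator of the countertermed effective action `hubbardEffectiveActionCT L M β U μ 0 K Λ` (seed `0`, frame `K`) on
its own renormalised band `e_K = nambuXiCT L μ K` — the finite-`(β, L, M)` ancestor of `formInf V_h^Γ`, `Λ = γ^h`,
of DECOMP App. E, Lemma E.4. -/
def klScaleBlockInf (β U μ : ℝ) (K : TrigPolyC4v) (Λ : ℝ) (χ : D4Irrep) : ℝ :=
  cooperChannelInf L M β (nambuXiCT L μ K) Λ (hubbardEffectiveActionCT L M β U μ 0 K Λ) χ

/-- The scale-`Λ` Cooper block tops of the KL programme at finite volume (see `klScaleBlockInf`). -/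
def klScaleBlockSup (β U μ : ℝ) (K : TrigPolyC4v) (Λ : ℝ) (χ : D4Irrep) : ℝ :=
  cooperChannelSup L M β (nambuXiCT L μ K) Λ (hubbardEffectiveActionCT L M β U μ 0 K Λ) χ

end FiniteVolume

/-! ## §3 Sector carriers: the permutation representation of an index action (append, p3 g2)

The blocks of DECOMP App. E Lemma E.4 live on finite SECTOR arrays (`ℓ²` of an index set `ι` of isotropic sectors at one
scale, e.g. `Fin (sectorCount (2n))` of `KLProgrammeSectorisedLegKernelsDefs` / `HubbardCooperVertexBlocks`), on which `D₄` acts by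
permuting indices (quarter turns shift, reflections reverse).  The generic carrier: -/

section PermCarrier

variable {ι : Type*} [Fintype ι] [DecidableEq ι]

/-- The **permutation representation** of `D₄` on `ℓ²(ι) = EuclideanSpace ℂ ι` induced by an action `σ : D₄ →* Perm ι` on the
index set: `(permRep σ g v) i = v (σ(g)⁻¹ i)`; each `permRep σ g` is a linear isometry (`LinearIsometryEquiv.piLpCongrLeft`).
The finite-volume `d4PermRep L` of §2 is the case `ι = TorusSite 2 L`, `σ = d4SitePerm`. -/
def permRep (σ : DihedralGroup 4 →* Equiv.Perm ι) (g : DihedralGroup 4) : EuclideanSpace ℂ ι →L[ℂ] EuclideanSpace ℂ ι :=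
  ((LinearIsometryEquiv.piLpCongrLeft 2 ℂ ℂ (σ g)).toContinuousLinearEquiv :
    EuclideanSpace ℂ ι →L[ℂ] EuclideanSpace ℂ ι)

/-- The operator of a matrix kernel on the sector carrier (`Matrix.toEuclideanCLM`): `(matrixOp K v) i = Σ_j K i j · v j`. -/
def matrixOp (K : Matrix ι ι ℂ) : EuclideanSpace ℂ ι →L[ℂ] EuclideanSpace ℂ ι :=
  Matrix.toEuclideanCLM (n := ι) (𝕜 := ℂ) K

/-- **Channel bottom of a matrix kernel on a sector carrier** with index action `σ`, irrep `χ` — the shape in which Lemma E.4's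
per-scale Cooper arrays `V_j(q; θ̄, θ̄')` are fed to C2 (`= formInf (blockOp (permRep σ) χ (matrixOp K) _)` when `K` is `σ`-covariant). -/
def matrixChannelInf (σ : DihedralGroup 4 →* Equiv.Perm ι) (K : Matrix ι ι ℂ) (χ : D4Irrep) : ℝ :=
  channelFormInf (permRep σ) (matrixOp K) χ

/-- Channel top of a matrix kernel on a sector carrier. -/
def matrixChannelSup (σ : DihedralGroup 4 →* Equiv.Perm ι) (K : Matrix ι ι ℂ) (χ : D4Irrep) : ℝ :=
  channelFormSup (permRep σ) (matrixOp K) χ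

end PermCarrier

end Summit.HubbardSuperconductivity.HubbardSuperconductivity.Theorems.CooperVertexBlocks

end
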